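import Literature.MathematicalPhysics.QuantumFieldTheory.ConformalBootstrap3D.PointKernelK34v2Data
import Literature.MathematicalPhysics.QuantumFieldTheory.ConformalBootstrap3D.PointKernelParts

/-!
# K34v2 certificate, kernel part file P1: one-cell head segments 4, 5, 64 in level ranges

The head cells whose kernel evaluation exceeds one `decide` are one-cell segments of `hsegsK34v2`; each is
checked by `PCert.hPartSideOK` (side conditions) and `PCert.hPartOK` per level range `[n_lo, n_lo + count)`
against an integer claim, the claims summing to `≥ 0` (`PointKernel.partsOK`); soundness is
`PCert.hParts_sound` (`PointKernelParts`).  The part files `P1, P2, …` are mutually independent (each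
imports only the data file); the ranges of one cell may span several of them, and the per-cell
conclusions `hparts_i` / `hcell_i` of those cells are assembled in `PointKernelK34v2.lean`.
Estimated kernel time 242 s.
-/

set_option maxRecDepth 100000
set_option maxHeartbeats 0

namespace Literature.MathematicalPhysics.QuantumFieldTheory.ConformalBootstrap3D.PointKernelK34v2

open Literature.MathematicalPhysics.QuantumFieldTheory.ConformalBootstrap3D.PointKernel

/-- levels `[0, 37)` of segment 4: partial lower sum `≥` claim. [folklore] -/
theorem part_4_0 : certK34v2.hPartOK (PCert.segAt hsegsK34v2 4) JHK34v2 0 37 (-234296191308520064776104974603632) = true := by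
  decide +kernel

/-- levels `[37, 39)` of segment 4: partial lower sum `≥` claim. [folklore] -/
theorem part_4_1 : certK34v2.hPartOK (PCert.segAt hsegsK34v2 4) JHK34v2 37 2 (234296191308520064776104974603632) = true := by
  decide +kernel

/-- one-cell segment 5 (row 0, cell `[771/512, 193/128]`, chord, `n_F = 30`,
1 level ranges): side conditions. [folklore] -/
theorem pside_5 : certK34v2.hPartSideOK (PCert.segAt hsegsK34v2 5) JHK34v2 = true := by
  decide +kernel

/-- its level ranges `(n_lo, count, claim)`. [folklore] -/
def parts_5 : List (ℕ × ℕ × ℤ) := [(0, 31, 0)]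

/-- the ranges tile `[0, n_F]` and the claims sum to `≥ 0`. [folklore] -/
theorem pcov_5 : PointKernel.partsOK 30 parts_5 = true := by
  decide +kernel

/-- levels `[0, 31)` of segment 5: partial lower sum `≥` claim. [folklore] -/
theorem part_5_0 : certK34v2.hPartOK (PCert.segAt hsegsK34v2 5) JHK34v2 0 31 (0) = true := by
  decide +kernel

/-- one-cell segment 64 (row 2, cell `[3, 1537/512]`, chord, `n_F = 52`,
3 level ranges): side conditions. [folklore] -/
theorem pside_64 : certK34v2.hPartSideOK (PCert.segAt hsegsK34v2 64) JHK34v2 = true := by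
  decide +kernel

/-- its level ranges `(n_lo, count, claim)`. [folklore] -/
def parts_64 : List (ℕ × ℕ × ℤ) := [(0, 33, -219692678058819127441714081232390076), (33, 13, 189533870074881092839742447474115982), (46, 7, 30158807983938034601971633758274096)]

/-- the ranges tile `[0, n_F]` and the claims sum to `≥ 0`. [folklore] -/
theorem pcov_64 : PointKernel.partsOK 52 parts_64 = true := by
  decide +kernel

/-- levels `[0, 33)` of segment 64: partial lower sum `≥` claim. [folklore] -/
theorem part_64_0 : certK34v2.hPartOK (PCert.segAt hsegsK34v2 64) JHK34v2 0 33 (-219692678058819127441714081232390076) = true := by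
  decide +kernel

/-- levels `[33, 46)` of segment 64: partial lower sum `≥` claim. [folklore] -/
theorem part_64_1 : certK34v2.hPartOK (PCert.segAt hsegsK34v2 64) JHK34v2 33 13 (189533870074881092839742447474115982) = true := by
  decide +kernel

end Literature.MathematicalPhysics.QuantumFieldTheory.ConformalBootstrap3D.PointKernelK34v2
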